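import Literature.NumberTheory.LFunctions.SelbergDelangeTheorem
import Literature.NumberTheory.LFunctions.SatheSelbergEulerProductAtOne
import Literature.NumberTheory.LFunctions.SatheSelbergProofs
import Mathlib.Analysis.Analytic.Binomial
import Mathlib.RingTheory.Binomial
import HarnessLib

/-!
# The Sathe–Selberg formula for `ω` from the Selberg–Delange theorem (MV Thm 7.18 ⇒ §7.4.1 Ex. 3(c))

Topic `NumberTheory/LFunctions`. Everything in this file is PROVED (four small definitions with
bodies, theorems; no named facts). It closes the gap between

* the NAMED FACT `MontgomeryVaughan2007_thm_7_18` (`SelbergDelangeTheorem.lean`: Montgomery–Vaughan,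
  *Multiplicative Number Theory I*, Theorem 7.18, the Selberg–Delange theorem for general
  coefficients `b_z`, with `d_z = zetaPowCoeff z` and `a_z = selbergDelangeCoeff b z`), and
* the PROVED passage "mean value of `z^{ω(n)}` ⇒ local laws for `ω(n) = k`"
  (`MontgomeryVaughan2007_exercise_7_4_3c_of_omegaMeanValue`, `SatheSelbergProofs.lean`),

so that the Sathe–Selberg formula `MontgomeryVaughan2007_exercise_7_4_3c` (`SatheSelberg.lean`)
becomes a THEOREM CONDITIONAL ON `MontgomeryVaughan2007_thm_7_18` ALONE:

* `MontgomeryVaughan2007_exercise_7_4_3c_of_thm_7_18 : MontgomeryVaughan2007_thm_7_18 →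
  MontgomeryVaughan2007_exercise_7_4_3c`.

## The verification of §7.4.1 Exercise 3(a),(b) for Theorem 7.18 (all proved here)

* `SatheSelberg.omegaB z` — the coefficients `b_z(m)` of `F(s,z) = ∏_p (1 + z/(p^s-1))(1-p^{-s})^z
  = ∑_m b_z(m) m^{-s}`: the multiplicative function (`mulFn`, via `Nat.factorization`) with
  `b_z(p^k) = c_z(k)`, `∑_k c_z(k) t^k = (1 + (z-1)t)(1-t)^{z-1}` (`localCoeff`,
  `hasSum_localCoeff_mul_pow`), i.e. `c_z(k) = multichoose (1-z) k + (z-1) multichoose (1-z) (k-1)`;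
  in particular `b_z(p) = 0` (`localCoeff_one`): `b_z` lives on the powerful numbers.
* `selbergDelangeCoeff_omegaB` — **Exercise 3(b)**: `a_z(n) = ∑_{m|n} b_z(m) d_z(n/m) = z^{ω(n)}`
  (`d_z(p^k) = multichoose z k`, `zetaPowCoeff_eq_mulFn`; Vandermonde for `multichoose`,
  `multichoose_add`, from Mathlib's `Ring.add_choose_eq` and `Ring.choose_neg'`; comparison of
  multiplicative functions on prime powers).
* `omegaB_hypothesis` — the hypothesis of Theorem 7.18 for every `R ≥ 1`:
  `|c_z(k)| ≤ (R+2)(k+1)^N` (`norm_multichoose_le`: `|multichoose w k| ≤ (k+1)^N` for `‖w‖ ≤ N`, by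
  Bernoulli), `(log m)^{2R+1}/m ≤ (4(2R+1))^{2R+1} m^{-3/4}`, and
  `∑_m |b_z(m)| m^{-3/4} ≤ exp(K ∑_p p^{-3/2})` (Euler product over smooth numbers,
  `exists_bound_tsum_norm_omegaB_rpow`).
* `selbergF_one_eq_tsum_omegaB` — **Exercise 3(a) at `s = 1`**: `∑_m b_z(m)/m = ∏_p E_p(1,z) =
  selbergF 1 z` (Mathlib's `EulerProduct.eulerProduct_tprod` and the binomial series
  `Complex.one_div_one_sub_cpow_hasFPowerSeriesOnBall_zero`), and
  `prod_eulerFactor_one_eq_satheSelbergFC` — `∏_{p ≤ x} E_p(1,z) = satheSelbergFC x z`.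
* `omegaMeanValue_of_thm_7_18` — Theorem 7.18 (with `R' = max(R,1)`) then gives Selberg's mean value
  formula for `z^{ω(n)}` in the truncated-product form used by `SatheSelbergProofs.lean`, the switch
  `F(1,z) ↦ F_x(z)` costing `O_R(x^{1/2}(log x)^{Re z-1}) ≤ O_R(x(log x)^{Re z-2})` by the tail bound
  `SatheSelberg.exists_norm_selbergF_one_sub_prod_le` (`SatheSelbergEulerProductAtOne.lean`).

## References

* [MontgomeryVaughan2007] H. L. Montgomery, R. C. Vaughan, *Multiplicative Number Theory I*, CUP 2007,
  §7.4 (7.56), Theorem 7.18, §7.4.1 Exercise 3(a)–(c). doi:10.1017/CBO9780511618314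
-/

noncomputable section

namespace Literature.NumberTheory.LFunctions

open Finset Filter


namespace SatheSelberg

open Finset

/-! ### Rising factorials and `multichoose` -/

/-- `∏_{j<k} (z + j) = (ascPochhammer ℕ k).smeval z`. [folklore] -/
theorem prod_range_add_natCast_eq_ascPochhammer (z : ℂ) (k : ℕ) :
    ∏ j ∈ Finset.range k, (z + (j : ℂ)) = (ascPochhammer ℕ k).smeval z := by
  induction k with
  | zero => simp
  | succ k ih =>
    rw [Finset.prod_range_succ, ih, ascPochhammer_succ_right, Polynomial.smeval_mul,
      Polynomial.smeval_add, Polynomial.smeval_X, Polynomial.smeval_natCast]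
    simp

/-- The local factor of `d_z`: `(∏_{j<k}(z+j))/k! = multichoose z k`. [folklore] -/
theorem prod_range_add_div_factorial (z : ℂ) (k : ℕ) :
    (∏ j ∈ Finset.range k, (z + (j : ℂ))) / (k.factorial : ℂ) = Ring.multichoose z k := by
  rw [prod_range_add_natCast_eq_ascPochhammer, ← Ring.factorial_nsmul_multichoose_eq_ascPochhammer,
    nsmul_eq_mul, mul_div_cancel_left₀ _ (by exact_mod_cast (Nat.factorial_pos k).ne')]

/-- `Int.negOnePow n` acts on `ℂ` as multiplication by `(-1)^n`. [folklore] -/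
theorem negOnePow_smul_eq (n : ℕ) (x : ℂ) : Int.negOnePow n • x = (-1 : ℂ) ^ n * x := by
  induction n with
  | zero => simp
  | succ n ih =>
    rw [Nat.cast_succ, Int.negOnePow_succ, Units.neg_smul, ih, pow_succ]
    ring

/-- **Vandermonde for `multichoose`**: `multichoose (r+s) k = ∑_{i+j=k} multichoose r i · multichoose s j`
(coefficients of `(1-t)^{-r}(1-t)^{-s} = (1-t)^{-(r+s)}`; from Mathlib's Chu–Vandermonde for
`Ring.choose` and upper negation `Ring.choose_neg'`). [folklore] -/
theorem multichoose_add (r s : ℂ) (k : ℕ) :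
    Ring.multichoose (r + s) k =
      ∑ i ∈ Finset.range (k + 1), Ring.multichoose r i * Ring.multichoose s (k - i) := by
  have h := Ring.add_choose_eq (r := -r) (s := -s) k (Commute.all _ _)
  rw [show -r + -s = -(r + s) by ring, Ring.choose_neg', negOnePow_smul_eq] at h
  simp_rw [Ring.choose_neg', negOnePow_smul_eq] at h
  rw [Finset.Nat.sum_antidiagonal_eq_sum_range_succ_mk] at h
  simp only at h
  have h2 : ∑ i ∈ Finset.range (k + 1), (-1 : ℂ) ^ i * Ring.multichoose r i *
      ((-1 : ℂ) ^ (k - i) * Ring.multichoose s (k - i)) =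
      (-1 : ℂ) ^ k * ∑ i ∈ Finset.range (k + 1), Ring.multichoose r i * Ring.multichoose s (k - i) := by
    rw [Finset.mul_sum]
    refine Finset.sum_congr rfl fun i hi => ?_
    have hik : i ≤ k := Nat.lt_succ_iff.1 (Finset.mem_range.1 hi)
    have : (-1 : ℂ) ^ i * (-1 : ℂ) ^ (k - i) = (-1) ^ k := by
      rw [← pow_add, Nat.add_sub_cancel' hik]
    calc (-1 : ℂ) ^ i * Ring.multichoose r i * ((-1 : ℂ) ^ (k - i) * Ring.multichoose s (k - i))
        = ((-1 : ℂ) ^ i * (-1 : ℂ) ^ (k - i)) * (Ring.multichoose r i * Ring.multichoose s (k - i)) := by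
          ring
      _ = _ := by rw [this]
  rw [h2] at h
  have hne : (-1 : ℂ) ^ k ≠ 0 := pow_ne_zero _ (by norm_num)
  exact mul_left_cancel₀ hne h

/-! ### Factorization-multiplicative functions -/

/-- The multiplicative function on `ℕ` with prescribed values `g p k` at prime powers `p^k`
(`g p 0` is never used but should be `1`); `0 ↦ 0`. [folklore] -/
def mulFn (g : ℕ → ℕ → ℂ) (n : ℕ) : ℂ :=
  if n = 0 then 0 else n.factorization.prod g

/-- `mulFn g 0 = 0`. [folklore] -/
theorem mulFn_zero (g : ℕ → ℕ → ℂ) : mulFn g 0 = 0 := by simp [mulFn]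

/-- `mulFn g 1 = 1`. [folklore] -/
theorem mulFn_one (g : ℕ → ℕ → ℂ) : mulFn g 1 = 1 := by simp [mulFn]

/-- At a prime power: `mulFn g (p^k) = g p k` (when `g p 0 = 1`). [folklore] -/
theorem mulFn_prime_pow (g : ℕ → ℕ → ℂ) {p : ℕ} (hp : p.Prime) (hg0 : g p 0 = 1) (k : ℕ) :
    mulFn g (p ^ k) = g p k := by
  rw [mulFn, if_neg (pow_ne_zero _ hp.ne_zero), Nat.Prime.factorization_pow hp,
    Finsupp.prod_single_index hg0]

/-- Multiplicativity: `mulFn g (m n) = mulFn g m * mulFn g n` for coprime `m, n`. [folklore] -/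
theorem mulFn_mul_of_coprime (g : ℕ → ℕ → ℂ) {m n : ℕ} (h : m.Coprime n) :
    mulFn g (m * n) = mulFn g m * mulFn g n := by
  rcases eq_or_ne m 0 with rfl | hm
  · simp [mulFn]
  rcases eq_or_ne n 0 with rfl | hn
  · simp [mulFn]
  rw [mulFn, if_neg (mul_ne_zero hm hn), mulFn, if_neg hm, mulFn, if_neg hn,
    Nat.factorization_mul_of_coprime h,
    Finsupp.prod_add_index_of_disjoint]
  simpa only [Nat.support_factorization] using h.disjoint_primeFactors

/-- `mulFn g` as an arithmetic function. [folklore] -/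
def mulArith (g : ℕ → ℕ → ℂ) : ArithmeticFunction ℂ :=
  ⟨mulFn g, mulFn_zero g⟩

/-- `mulArith g n = mulFn g n`. [folklore] -/
theorem mulArith_apply (g : ℕ → ℕ → ℂ) (n : ℕ) : mulArith g n = mulFn g n := rfl

/-- `mulArith g` is multiplicative. [folklore] -/
theorem isMultiplicative_mulArith (g : ℕ → ℕ → ℂ) : (mulArith g).IsMultiplicative :=
  ⟨mulFn_one g, fun h => mulFn_mul_of_coprime g h⟩


/-! ### `d_z` is `mulFn` with local factor `multichoose z k` -/

/-- Montgomery–Vaughan's `d_z(n)` (`zetaPowCoeff`) is the multiplicative function with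
`d_z(p^k) = multichoose z k = z(z+1)⋯(z+k-1)/k!`. [cite: MontgomeryVaughan2007, §7.4 (7.56)] -/
theorem zetaPowCoeff_eq_mulFn (z : ℂ) (n : ℕ) :
    zetaPowCoeff z n = mulFn (fun _ k => Ring.multichoose z k) n := by
  unfold zetaPowCoeff mulFn
  split_ifs with h
  · rfl
  · refine Finsupp.prod_congr fun p _ => ?_
    exact prod_range_add_div_factorial z _

/-! ### The coefficients `b_z` of `F(s,z) = ∏_p (1 + z/(p^s - 1))(1 - p^{-s})^z` -/

/-- The local coefficients: `∑_k c_z(k) t^k = (1 + zt/(1-t))(1-t)^z = (1 + (z-1)t)(1-t)^{z-1}`, i.e.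
`c_z(0) = 1`, `c_z(k) = multichoose (1-z) k + (z-1) multichoose (1-z) (k-1)` (`k ≥ 1`); note
`c_z(1) = 0`. [cite: MontgomeryVaughan2007, §7.4.1 Exercise 3(a)] -/
def localCoeff (z : ℂ) (k : ℕ) : ℂ :=
  Ring.multichoose (1 - z) k + (z - 1) * (if k = 0 then 0 else Ring.multichoose (1 - z) (k - 1))

/-- `c_z(0) = 1`. [folklore] -/
theorem localCoeff_zero (z : ℂ) : localCoeff z 0 = 1 := by
  simp [localCoeff]

/-- `c_z(1) = 0`: `b_z` vanishes at primes (it is supported on the powerful numbers). [folklore] -/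
theorem localCoeff_one (z : ℂ) : localCoeff z 1 = 0 := by
  simp [localCoeff]

/-- `c_z(k+1) = multichoose (1-z) (k+1) + (z-1) multichoose (1-z) k`. [folklore] -/
theorem localCoeff_succ (z : ℂ) (k : ℕ) :
    localCoeff z (k + 1) = Ring.multichoose (1 - z) (k + 1) + (z - 1) * Ring.multichoose (1 - z) k := by
  simp [localCoeff]

/-- The coefficients `b_z(m)` of the Dirichlet series `F(s,z) = ∑_m b_z(m) m^{-s} =
∏_p (1 + z/(p^s-1))(1-p^{-s})^z`: the multiplicative function with `b_z(p^k) = c_z(k)`.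
[cite: MontgomeryVaughan2007, §7.4.1 Exercise 3(a)] -/
def omegaB (z : ℂ) (n : ℕ) : ℂ := mulFn (fun _ k => localCoeff z k) n

/-- `b_z(0) = 0`, `b_z(1) = 1`. [folklore] -/
theorem omegaB_one (z : ℂ) : omegaB z 1 = 1 := mulFn_one _

/-- `b_z(p^k) = c_z(k)`. [folklore] -/
theorem omegaB_prime_pow (z : ℂ) {p : ℕ} (hp : p.Prime) (k : ℕ) : omegaB z (p ^ k) = localCoeff z k :=
  mulFn_prime_pow _ hp (localCoeff_zero z) k

/-! ### The convolution identity `b_z * d_z = z^{ω}` -/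

/-- The local identity: `∑_{i ≤ k} c_z(i) · multichoose z (k-i) = z` for `k ≥ 1`
(`(1 + (z-1)t)(1-t)^{z-1} · (1-t)^{-z} = (1+(z-1)t)/(1-t) = 1 + z t + z t² + ⋯`, via Vandermonde with
`(1-z) + z = 1` and `multichoose 1 j = 1`). [cite: MontgomeryVaughan2007, §7.4.1 Exercise 3(b)] -/
theorem sum_localCoeff_mul_multichoose (z : ℂ) {k : ℕ} (hk : 1 ≤ k) :
    ∑ i ∈ Finset.range (k + 1), localCoeff z i * Ring.multichoose z (k - i) = z := by
  obtain ⟨m, rfl⟩ : ∃ m, k = m + 1 := ⟨k - 1, by omega⟩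
  -- split `c_z(i)` into its two parts
  have hV1 : ∑ i ∈ Finset.range (m + 1 + 1), Ring.multichoose (1 - z) i * Ring.multichoose z (m + 1 - i) = 1 := by
    rw [← multichoose_add, sub_add_cancel, Ring.multichoose_one]
  have hV2 : ∑ i ∈ Finset.range (m + 1), Ring.multichoose (1 - z) i * Ring.multichoose z (m - i) = 1 := by
    rw [← multichoose_add, sub_add_cancel, Ring.multichoose_one]
  have hsplit : ∀ i ∈ Finset.range (m + 1 + 1), localCoeff z i * Ring.multichoose z (m + 1 - i) =
      Ring.multichoose (1 - z) i * Ring.multichoose z (m + 1 - i) +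
        (z - 1) * ((if i = 0 then 0 else Ring.multichoose (1 - z) (i - 1)) * Ring.multichoose z (m + 1 - i)) := by
    intro i _
    rw [localCoeff]; ring
  rw [Finset.sum_congr rfl hsplit, Finset.sum_add_distrib, hV1, ← Finset.mul_sum]
  -- the shifted sum equals `hV2`
  have hshift : ∑ i ∈ Finset.range (m + 1 + 1),
      (if i = 0 then 0 else Ring.multichoose (1 - z) (i - 1)) * Ring.multichoose z (m + 1 - i) =
      ∑ i ∈ Finset.range (m + 1), Ring.multichoose (1 - z) i * Ring.multichoose z (m - i) := by
    rw [Finset.sum_range_succ' (fun i => (if i = 0 then 0 else Ring.multichoose (1 - z) (i - 1)) *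
      Ring.multichoose z (m + 1 - i))]
    simp only [Nat.succ_ne_zero, if_false, if_true, zero_mul, add_zero, Nat.add_sub_cancel,
      Nat.add_sub_add_right]
  rw [hshift, hV2]
  ring

/-- **`a_z(n) = z^{ω(n)}`** (Montgomery–Vaughan §7.4.1 Exercise 3(b)): with `b_z = omegaB z`,
`∑_{m | n} b_z(m) d_z(n/m) = z^{ω(n)}` for `n ≥ 1`, i.e.
`selbergDelangeCoeff omegaB z n = z^{ω(n)}`. [cite: MontgomeryVaughan2007, §7.4.1 Exercise 3(b)] -/
theorem selbergDelangeCoeff_omegaB (z : ℂ) {n : ℕ} (hn : n ≠ 0) :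
    selbergDelangeCoeff omegaB z n = z ^ (ArithmeticFunction.cardDistinctFactors n) := by
  -- the convolution as a product of multiplicative arithmetic functions
  set B : ArithmeticFunction ℂ := mulArith (fun _ k => localCoeff z k) with hB
  set D : ArithmeticFunction ℂ := mulArith (fun _ k => Ring.multichoose z k) with hD
  have hBm : B.IsMultiplicative := isMultiplicative_mulArith _
  have hDm : D.IsMultiplicative := isMultiplicative_mulArith _
  have hconv : ∀ n : ℕ, selbergDelangeCoeff omegaB z n = (B * D) n := by
    intro n
    rw [selbergDelangeCoeff, ArithmeticFunction.mul_apply, ← Nat.sum_divisorsAntidiagonal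
      (f := fun x y => omegaB z x * zetaPowCoeff z y)]
    refine Finset.sum_congr rfl fun ij _ => ?_
    rw [hB, hD, mulArith_apply, mulArith_apply, zetaPowCoeff_eq_mulFn]
    rfl
  -- the right-hand side is multiplicative too: `n ↦ z^{ω(n)}`
  set W : ArithmeticFunction ℂ := ⟨fun n => if n = 0 then 0 else z ^ (ArithmeticFunction.cardDistinctFactors n),
    by simp⟩ with hW
  have hWm : W.IsMultiplicative := by
    refine ⟨by simp [hW], fun {m n} hmn => ?_⟩
    simp only [hW, ArithmeticFunction.coe_mk, mul_eq_zero]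
    rcases eq_or_ne m 0 with rfl | hm
    · simp
    rcases eq_or_ne n 0 with rfl | hn'
    · simp
    rw [if_neg (by tauto), if_neg hm, if_neg hn', ArithmeticFunction.cardDistinctFactors_mul hmn, pow_add]
  -- equality of multiplicative functions: check prime powers
  have hBD : (B * D) = W := by
    refine ArithmeticFunction.IsMultiplicative.eq_iff_eq_on_prime_powers _ (hBm.mul hDm) _ hWm |>.2 ?_
    intro p k hp
    rw [← hconv, selbergDelangeCoeff, Nat.divisors_prime_pow hp, Finset.sum_map]
    simp only [Function.Embedding.coeFn_mk, hW, ArithmeticFunction.coe_mk,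
      if_neg (pow_ne_zero k hp.ne_zero)]
    have hterm : ∀ i ∈ Finset.range (k + 1), omegaB z (p ^ i) * zetaPowCoeff z (p ^ k / p ^ i) =
        localCoeff z i * Ring.multichoose z (k - i) := by
      intro i hi
      have hik : i ≤ k := Nat.lt_succ_iff.1 (Finset.mem_range.1 hi)
      rw [Nat.pow_div hik hp.pos, omegaB_prime_pow z hp, zetaPowCoeff_eq_mulFn,
        mulFn_prime_pow _ hp (Ring.multichoose_zero_right z)]
    rw [Finset.sum_congr rfl hterm]
    rcases Nat.eq_zero_or_pos k with rfl | hk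
    · simp [localCoeff_zero]
    · rw [sum_localCoeff_mul_multichoose z hk, ArithmeticFunction.cardDistinctFactors_apply_prime_pow hp hk.ne',
        pow_one]
  rw [hconv, hBD]
  simp [hW, hn]

/-! ### Bounds for `multichoose` and for the local coefficients -/

/-- `∏_{j<k} (N + j) ≤ k! (k+1)^N` (`N ∈ ℕ`), by induction with Bernoulli's inequality. [folklore] -/
theorem prod_range_natCast_add_le (N k : ℕ) :
    ∏ j ∈ Finset.range k, ((N : ℝ) + j) ≤ (k.factorial : ℝ) * ((k : ℝ) + 1) ^ N := by
  induction k with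
  | zero => simp
  | succ k ih =>
    rw [Finset.prod_range_succ, Nat.factorial_succ]
    push_cast
    have h0 : 0 ≤ ∏ j ∈ Finset.range k, ((N : ℝ) + j) :=
      Finset.prod_nonneg fun j _ => by positivity
    have hk1 : (0 : ℝ) < (k : ℝ) + 1 := by positivity
    -- Bernoulli: `(1 + 1/(k+1))^N ≥ 1 + N/(k+1)`
    have hB : 1 + (N : ℝ) * (1 / ((k : ℝ) + 1)) ≤ (1 + 1 / ((k : ℝ) + 1)) ^ N :=
      one_add_mul_le_pow (by rw [one_div]; have := inv_pos.2 hk1; linarith) N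
    have hkey : ((k : ℝ) + 1) ^ N * ((N : ℝ) + k) ≤ ((k : ℝ) + 1) * ((k : ℝ) + 1 + 1) ^ N := by
      have e : ((k : ℝ) + 1 + 1) = ((k : ℝ) + 1) * (1 + 1 / ((k : ℝ) + 1)) := by field_simp
      rw [e, mul_pow]
      have h1 : ((k : ℝ) + 1) ^ N * ((N : ℝ) + k) ≤ ((k : ℝ) + 1) ^ N * (((k : ℝ) + 1) *
          (1 + (N : ℝ) * (1 / ((k : ℝ) + 1)))) := by
        gcongr
        have hh : ((k : ℝ) + 1) * (N : ℝ) * (1 / ((k : ℝ) + 1)) = N := by field_simp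
        linarith [hh]
      calc _ ≤ _ := h1
        _ ≤ ((k : ℝ) + 1) ^ N * (((k : ℝ) + 1) * (1 + 1 / ((k : ℝ) + 1)) ^ N) := by gcongr
        _ = _ := by ring
    calc (∏ j ∈ Finset.range k, ((N : ℝ) + j)) * ((N : ℝ) + k)
        ≤ ((k.factorial : ℝ) * ((k : ℝ) + 1) ^ N) * ((N : ℝ) + k) := by gcongr
      _ = (k.factorial : ℝ) * (((k : ℝ) + 1) ^ N * ((N : ℝ) + k)) := by ring
      _ ≤ (k.factorial : ℝ) * (((k : ℝ) + 1) * ((k : ℝ) + 1 + 1) ^ N) := by gcongr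
      _ = ((k : ℝ) + 1) * (k.factorial : ℝ) * ((k : ℝ) + 1 + 1) ^ N := by ring

/-- **`|multichoose w k| ≤ (k+1)^N`** for `‖w‖ ≤ N ∈ ℕ` (`|w(w+1)⋯(w+k-1)| ≤ N(N+1)⋯(N+k-1) ≤ k!(k+1)^N`).
[folklore] -/
theorem norm_multichoose_le {w : ℂ} {N : ℕ} (hw : ‖w‖ ≤ N) (k : ℕ) :
    ‖Ring.multichoose w k‖ ≤ ((k : ℝ) + 1) ^ N := by
  rw [← prod_range_add_div_factorial, norm_div, Complex.norm_natCast, norm_prod,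
    div_le_iff₀ (by exact_mod_cast Nat.factorial_pos k)]
  calc ∏ j ∈ Finset.range k, ‖w + (j : ℂ)‖ ≤ ∏ j ∈ Finset.range k, ((N : ℝ) + j) := by
        refine Finset.prod_le_prod (fun j _ => norm_nonneg _) fun j _ => ?_
        calc ‖w + (j : ℂ)‖ ≤ ‖w‖ + ‖(j : ℂ)‖ := norm_add_le _ _
          _ ≤ N + j := by rw [Complex.norm_natCast]; gcongr
    _ ≤ (k.factorial : ℝ) * ((k : ℝ) + 1) ^ N := prod_range_natCast_add_le N k
    _ = ((k : ℝ) + 1) ^ N * k.factorial := mul_comm _ _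

/-- **`|c_z(k)| ≤ (R+2)(k+1)^N`** for `‖z‖ ≤ R`, `N = ⌈R⌉₊ + 1`. [folklore] -/
theorem norm_localCoeff_le {z : ℂ} {R : ℝ} (hR : 0 ≤ R) (hz : ‖z‖ ≤ R) (k : ℕ) :
    ‖localCoeff z k‖ ≤ (R + 2) * ((k : ℝ) + 1) ^ (⌈R⌉₊ + 1) := by
  set N : ℕ := ⌈R⌉₊ + 1 with hN
  have hw : ‖(1 : ℂ) - z‖ ≤ N := by
    calc ‖(1 : ℂ) - z‖ ≤ ‖(1 : ℂ)‖ + ‖z‖ := norm_sub_le _ _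
      _ ≤ 1 + R := by rw [norm_one]; gcongr
      _ ≤ N := by rw [hN]; push_cast; linarith [Nat.le_ceil R]
  have hk1 : (1 : ℝ) ≤ ((k : ℝ) + 1) ^ N := one_le_pow₀ (by simp)
  rcases Nat.eq_zero_or_pos k with rfl | hk
  · rw [localCoeff_zero, norm_one]
    simp only [Nat.cast_zero, zero_add, one_pow, mul_one]
    linarith
  · obtain ⟨j, rfl⟩ : ∃ j, k = j + 1 := ⟨k - 1, by omega⟩
    rw [localCoeff_succ]
    have h1 := norm_multichoose_le hw (j + 1)
    have h2 := norm_multichoose_le hw j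
    have h3 : ‖z - 1‖ ≤ R + 1 := by
      calc ‖z - 1‖ ≤ ‖z‖ + ‖(1 : ℂ)‖ := norm_sub_le _ _
        _ ≤ R + 1 := by rw [norm_one]; gcongr
    have h4 : ((j : ℝ) + 1) ^ N ≤ (((j + 1 : ℕ) : ℝ) + 1) ^ N := by
      push_cast; gcongr; linarith
    calc ‖Ring.multichoose (1 - z) (j + 1) + (z - 1) * Ring.multichoose (1 - z) j‖
        ≤ ‖Ring.multichoose (1 - z) (j + 1)‖ + ‖z - 1‖ * ‖Ring.multichoose (1 - z) j‖ := by
          refine (norm_add_le _ _).trans ?_; rw [norm_mul]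
      _ ≤ (((j + 1 : ℕ) : ℝ) + 1) ^ N + (R + 1) * (((j + 1 : ℕ) : ℝ) + 1) ^ N := by
          gcongr
          exact h2.trans h4
      _ = (R + 2) * (((j + 1 : ℕ) : ℝ) + 1) ^ N := by ring

/-! ### The weighted sum `∑_m |b_z(m)| m^{-3/4}` is bounded uniformly in `|z| ≤ R` -/

set_option maxHeartbeats 400000 in
/-- The majorant `F(m) = |b_z(m)| m^{-3/4}` is non-negative, multiplicative, `F(1) = 1`. Local sums:
`∑_e F(p^e) ≤ exp(K p^{-3/2})` with `K = (R+2) ∑_j (j+3)^N (2^{-3/4})^j`. Hence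
`∑_m |b_z(m)| m^{-3/4} ≤ exp(K ∑_p p^{-3/2})`, uniformly for `|z| ≤ R`. [folklore] -/
theorem exists_bound_tsum_norm_omegaB_rpow (R : ℝ) (hR : 0 ≤ R) :
    ∃ B : ℝ, ∀ z : ℂ, ‖z‖ ≤ R →
      Summable (fun m : ℕ => ‖omegaB z m‖ * (m : ℝ) ^ (-(3 / 4 : ℝ))) ∧
      ∑' m : ℕ, ‖omegaB z m‖ * (m : ℝ) ^ (-(3 / 4 : ℝ)) ≤ B := by
  set N : ℕ := ⌈R⌉₊ + 1 with hN
  set q₀ : ℝ := (2 : ℝ) ^ (-(3 / 4 : ℝ)) with hq₀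
  have hq₀pos : 0 < q₀ := Real.rpow_pos_of_pos two_pos _
  have hq₀lt : q₀ < 1 := Real.rpow_lt_one_of_one_lt_of_neg one_lt_two (by norm_num)
  -- the constant `K`
  have hgeom : Summable fun j : ℕ => ((j : ℝ) + 3) ^ N * q₀ ^ j := by
    have h1 : Summable fun n : ℕ => (n : ℝ) ^ N * q₀ ^ n :=
      summable_pow_mul_geometric_of_norm_lt_one N (by rw [Real.norm_of_nonneg hq₀pos.le]; exact hq₀lt)
    have h2 : Summable fun j : ℕ => (((j + 3 : ℕ) : ℝ)) ^ N * q₀ ^ (j + 3) :=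
      (summable_nat_add_iff 3).2 h1
    have h3 : Summable fun j : ℕ => (q₀ ^ 3)⁻¹ * ((((j + 3 : ℕ) : ℝ)) ^ N * q₀ ^ (j + 3)) :=
      h2.mul_left _
    refine h3.congr fun j => ?_
    push_cast
    field_simp
    ring
  set K : ℝ := (R + 2) * ∑' j : ℕ, ((j : ℝ) + 3) ^ N * q₀ ^ j with hK
  have hK0 : 0 ≤ K := by
    have : 0 ≤ ∑' j : ℕ, ((j : ℝ) + 3) ^ N * q₀ ^ j := tsum_nonneg fun j => by positivity
    positivity
  have hS : Summable fun p : Nat.Primes => ((p : ℕ) : ℝ) ^ (-(3 / 2 : ℝ)) :=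
    Nat.Primes.summable_rpow.2 (by norm_num)
  set S : ℝ := ∑' p : Nat.Primes, ((p : ℕ) : ℝ) ^ (-(3 / 2 : ℝ)) with hSdef
  have hSp0 : ∀ p : Nat.Primes, 0 ≤ ((p : ℕ) : ℝ) ^ (-(3 / 2 : ℝ)) := fun p =>
    Real.rpow_nonneg (Nat.cast_nonneg _) _
  refine ⟨Real.exp (K * S), fun z hz => ?_⟩
  set F : ℕ → ℝ := fun m => ‖omegaB z m‖ * (m : ℝ) ^ (-(3 / 4 : ℝ)) with hF
  have hF0 : ∀ m, 0 ≤ F m := fun m => by positivity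
  have hF1 : F 1 = 1 := by simp [hF, omegaB_one]
  have hFmul : ∀ {m n : ℕ}, m.Coprime n → F (m * n) = F m * F n := by
    intro m n hmn
    simp only [hF, omegaB, mulFn_mul_of_coprime _ hmn, norm_mul, Nat.cast_mul,
      Real.mul_rpow (Nat.cast_nonneg m) (Nat.cast_nonneg n)]
    ring
  -- local terms at a prime `p`: `F(p^e) = |c_z(e)| q^e`, `q = p^{-3/4} ≤ q₀`
  have hloc_eq : ∀ {p : ℕ}, p.Prime → ∀ e : ℕ,
      F (p ^ e) = ‖localCoeff z e‖ * ((p : ℝ) ^ (-(3 / 4 : ℝ))) ^ e := by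
    intro p hp e
    simp only [hF, omegaB_prime_pow z hp, Nat.cast_pow]
    rw [← Real.rpow_natCast ((p : ℝ) ^ (-(3 / 4 : ℝ))) e, ← Real.rpow_mul (Nat.cast_nonneg p),
      ← Real.rpow_natCast (p : ℝ) e, ← Real.rpow_mul (Nat.cast_nonneg p)]
    ring_nf
  have hq : ∀ {p : ℕ}, p.Prime → 0 ≤ (p : ℝ) ^ (-(3 / 4 : ℝ)) ∧ (p : ℝ) ^ (-(3 / 4 : ℝ)) ≤ q₀ := by
    intro p hp
    refine ⟨Real.rpow_nonneg (Nat.cast_nonneg _) _, ?_⟩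
    exact Real.rpow_le_rpow_of_nonpos two_pos (by exact_mod_cast hp.two_le) (by norm_num)
  have hbound : ∀ {p : ℕ}, p.Prime → ∀ e : ℕ,
      F (p ^ (e + 2)) ≤ (R + 2) * (((e : ℝ) + 3) ^ N * q₀ ^ e) * ((p : ℝ) ^ (-(3 / 4 : ℝ))) ^ 2 := by
    intro p hp e
    obtain ⟨hq0, hqle⟩ := hq hp
    rw [hloc_eq hp]
    have h1 := norm_localCoeff_le hR hz (e + 2)
    have h2 : ((p : ℝ) ^ (-(3 / 4 : ℝ))) ^ (e + 2) ≤ q₀ ^ e * ((p : ℝ) ^ (-(3 / 4 : ℝ))) ^ 2 := by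
      rw [pow_add]; gcongr
    have h3 : (((e + 2 : ℕ) : ℝ) + 1) ^ N = ((e : ℝ) + 3) ^ N := by push_cast; ring
    rw [h3] at h1
    calc ‖localCoeff z (e + 2)‖ * ((p : ℝ) ^ (-(3 / 4 : ℝ))) ^ (e + 2)
        ≤ ((R + 2) * ((e : ℝ) + 3) ^ N) * (q₀ ^ e * ((p : ℝ) ^ (-(3 / 4 : ℝ))) ^ 2) :=
          mul_le_mul h1 h2 (by positivity) (by positivity)
      _ = _ := by ring
  have hFsum : ∀ {p : ℕ}, p.Prime → Summable (fun e : ℕ => ‖F (p ^ e)‖) := by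
    intro p hp
    simp only [Real.norm_of_nonneg (hF0 _)]
    rw [← summable_nat_add_iff 2]
    refine Summable.of_nonneg_of_le (fun e => hF0 _) (hbound hp) ?_
    exact ((hgeom.mul_left (R + 2)).mul_right _)
  have hloc : ∀ {p : ℕ}, p.Prime → ∑' e : ℕ, F (p ^ e) ≤ Real.exp (K * (p : ℝ) ^ (-(3 / 2 : ℝ))) := by
    intro p hp
    obtain ⟨hq0, hqle⟩ := hq hp
    have hs : Summable fun e : ℕ => F (p ^ e) := by
      have := hFsum hp; simpa [Real.norm_of_nonneg (hF0 _)] using this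
    have hFp : F p = 0 := by
      have := hloc_eq hp 1
      rw [pow_one, pow_one, localCoeff_one, norm_zero, zero_mul] at this
      exact this
    rw [hs.tsum_eq_zero_add, ((summable_nat_add_iff 1).2 hs).tsum_eq_zero_add]
    simp only [zero_add, pow_zero, pow_one, hF1, hFp]
    have htail : ∑' e : ℕ, F (p ^ (e + 1 + 1)) ≤ K * ((p : ℝ) ^ (-(3 / 4 : ℝ))) ^ 2 := by
      have hs2 : Summable fun e : ℕ => F (p ^ (e + 2)) := (summable_nat_add_iff 2).2 hs
      calc ∑' e : ℕ, F (p ^ (e + 1 + 1)) = ∑' e : ℕ, F (p ^ (e + 2)) := rfl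
        _ ≤ ∑' e : ℕ, (R + 2) * (((e : ℝ) + 3) ^ N * q₀ ^ e) * ((p : ℝ) ^ (-(3 / 4 : ℝ))) ^ 2 :=
            hs2.tsum_le_tsum (hbound hp) ((hgeom.mul_left (R + 2)).mul_right _)
        _ = K * ((p : ℝ) ^ (-(3 / 4 : ℝ))) ^ 2 := by
            rw [tsum_mul_right, tsum_mul_left, hK]
    have hsq : ((p : ℝ) ^ (-(3 / 4 : ℝ))) ^ 2 = (p : ℝ) ^ (-(3 / 2 : ℝ)) := by
      rw [← Real.rpow_natCast, ← Real.rpow_mul (Nat.cast_nonneg p)]; norm_num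
    rw [hsq] at htail
    calc 1 + ∑' e : ℕ, F (p ^ (e + 1 + 1)) ≤ 1 + K * (p : ℝ) ^ (-(3 / 2 : ℝ)) := by linarith
      _ ≤ Real.exp (K * (p : ℝ) ^ (-(3 / 2 : ℝ))) := by
          have := Real.add_one_le_exp (K * (p : ℝ) ^ (-(3 / 2 : ℝ))); linarith
  -- partial sums via smooth numbers
  have hpartial : ∀ M : ℕ, ∑ n ∈ Finset.range M, F n ≤ Real.exp (K * S) := by
    intro M
    obtain ⟨-, hhas⟩ :=
      EulerProduct.summable_and_hasSum_smoothNumbers_prod_primesBelow_tsum hF1 hFmul hFsum M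
    have h1 : ∑ n ∈ Finset.range M, F n = ∑ n ∈ Finset.Ico 1 M, F n := by
      rcases Nat.eq_zero_or_pos M with rfl | hM
      · simp
      · rw [Finset.range_eq_Ico, ← Finset.sum_Ico_consecutive _ (Nat.zero_le 1) hM]
        simp [hF, omegaB, mulFn_zero]
    have h2 : ∑ n ∈ Finset.Ico 1 M, F n = ∑ m ∈ (Finset.Ico 1 M).subtype (· ∈ M.smoothNumbers), F (m : ℕ) := by
      rw [Finset.sum_subtype_eq_sum_filter]
      refine Finset.sum_congr ?_ fun _ _ => rfl
      refine (Finset.filter_true_of_mem fun d hd => ?_).symm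
      rw [Finset.mem_Ico] at hd
      exact Nat.mem_smoothNumbers_of_lt hd.1 hd.2
    have h3 : ∑ m ∈ (Finset.Ico 1 M).subtype (· ∈ M.smoothNumbers), F (m : ℕ) ≤
        ∏ p ∈ M.primesBelow, ∑' e : ℕ, F (p ^ e) :=
      sum_le_hasSum _ (fun m _ => hF0 _) hhas
    have h4 : ∏ p ∈ M.primesBelow, ∑' e : ℕ, F (p ^ e) ≤
        ∏ p ∈ M.primesBelow, Real.exp (K * (p : ℝ) ^ (-(3 / 2 : ℝ))) := by
      refine Finset.prod_le_prod (fun p _ => tsum_nonneg fun e => hF0 _) fun p hp => ?_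
      exact hloc (Nat.prime_of_mem_primesBelow hp)
    have h5 : ∏ p ∈ M.primesBelow, Real.exp (K * (p : ℝ) ^ (-(3 / 2 : ℝ))) =
        Real.exp (K * ∑ p ∈ M.primesBelow, (p : ℝ) ^ (-(3 / 2 : ℝ))) := by
      rw [Finset.mul_sum, Real.exp_sum]
    have h6 : ∑ p ∈ M.primesBelow, (p : ℝ) ^ (-(3 / 2 : ℝ)) ≤ S := by
      have hprime : ∀ p ∈ M.primesBelow, Nat.Prime p := fun p hp => Nat.prime_of_mem_primesBelow hp
      have e : ∑ p ∈ M.primesBelow, (p : ℝ) ^ (-(3 / 2 : ℝ)) =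
          ∑ p ∈ (M.primesBelow).subtype Nat.Prime, ((p : ℕ) : ℝ) ^ (-(3 / 2 : ℝ)) := by
        conv_lhs => rw [← Finset.filter_true_of_mem hprime, ← Finset.subtype_map, Finset.sum_map]
        rfl
      rw [e]
      exact sum_le_hasSum (f := fun p : Nat.Primes => ((p : ℕ) : ℝ) ^ (-(3 / 2 : ℝ))) _
        (fun p _ => hSp0 p) hS.hasSum
    calc ∑ n ∈ Finset.range M, F n = ∑ n ∈ Finset.Ico 1 M, F n := h1
      _ ≤ ∏ p ∈ M.primesBelow, ∑' e : ℕ, F (p ^ e) := h2 ▸ h3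
      _ ≤ Real.exp (K * ∑ p ∈ M.primesBelow, (p : ℝ) ^ (-(3 / 2 : ℝ))) := h5 ▸ h4
      _ ≤ Real.exp (K * S) := by gcongr
  have hsum : Summable F := summable_of_sum_range_le hF0 hpartial
  exact ⟨hsum, hsum.tsum_le_of_sum_range_le hpartial⟩

/-- `(log m)^A ≤ (4A)^A m^{1/4}` for `m ≥ 1`... in the form used: for real `A ≥ 1` and natural `m`,
`(log m)^A / m ≤ (4A)^A m^{-3/4}` (`m = 0`: both sides `0`… we only need `m ≥ 1`). [folklore] -/
theorem log_rpow_div_le {A : ℝ} (hA : 1 ≤ A) {m : ℕ} (hm : 1 ≤ m) :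
    Real.log m ^ A / m ≤ (4 * A) ^ A * (m : ℝ) ^ (-(3 / 4 : ℝ)) := by
  have hm0 : (0 : ℝ) < m := by exact_mod_cast hm
  have hlog0 : 0 ≤ Real.log m := Real.log_nonneg (by exact_mod_cast hm)
  -- `log m ≤ 4A · m^{1/(4A)}`
  have h1 : Real.log m ≤ (m : ℝ) ^ (1 / (4 * A)) / (1 / (4 * A)) :=
    Real.log_le_rpow_div hm0.le (by positivity)
  have h1' : Real.log m ≤ (4 * A) * (m : ℝ) ^ (1 / (4 * A)) := by
    rw [div_div_eq_mul_div, div_one, mul_comm] at h1; exact h1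
  have h2 : Real.log m ^ A ≤ ((4 * A) * (m : ℝ) ^ (1 / (4 * A))) ^ A :=
    Real.rpow_le_rpow hlog0 h1' (by linarith)
  rw [Real.mul_rpow (by positivity) (Real.rpow_nonneg hm0.le _), ← Real.rpow_mul hm0.le,
    show 1 / (4 * A) * A = 1 / 4 by field_simp] at h2
  rw [div_le_iff₀ hm0]
  calc Real.log m ^ A ≤ (4 * A) ^ A * (m : ℝ) ^ (1 / 4 : ℝ) := h2
    _ = (4 * A) ^ A * (m : ℝ) ^ (-(3 / 4 : ℝ)) * m := by
        rw [mul_assoc, ← Real.rpow_add_one hm0.ne']; norm_num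

/-- **The hypothesis of Theorem 7.18 for `b_z = omegaB z`**, for every `R ≥ 1`: some `B` bounds
`|b_z(1)|` and `∑_m |b_z(m)| (log m)^{2R+1}/m` (convergent) for all `|z| ≤ R`.
[cite: MontgomeryVaughan2007, §7.4.1 Exercise 3(a)] -/
theorem omegaB_hypothesis (R : ℝ) (hR : 1 ≤ R) :
    ∃ B : ℝ, ∀ z : ℂ, ‖z‖ ≤ R →
      ‖omegaB z 1‖ ≤ B ∧
      Summable (fun m : ℕ => ‖omegaB z m‖ * Real.log m ^ (2 * R + 1) / m) ∧
      ∑' m : ℕ, ‖omegaB z m‖ * Real.log m ^ (2 * R + 1) / m ≤ B := by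
  obtain ⟨B₀, hB₀⟩ := exists_bound_tsum_norm_omegaB_rpow R (by linarith)
  set A : ℝ := 2 * R + 1 with hA
  have hA1 : 1 ≤ A := by linarith
  refine ⟨max 1 ((4 * A) ^ A * B₀), fun z hz => ?_⟩
  obtain ⟨hs, hle⟩ := hB₀ z hz
  have hdom : ∀ m : ℕ, ‖omegaB z m‖ * Real.log m ^ A / m ≤
      (4 * A) ^ A * (‖omegaB z m‖ * (m : ℝ) ^ (-(3 / 4 : ℝ))) := by
    intro m
    rcases Nat.eq_zero_or_pos m with rfl | hm
    · simp [omegaB, mulFn_zero]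
    · have := log_rpow_div_le hA1 hm
      calc ‖omegaB z m‖ * Real.log m ^ A / m = ‖omegaB z m‖ * (Real.log m ^ A / m) := by ring
        _ ≤ ‖omegaB z m‖ * ((4 * A) ^ A * (m : ℝ) ^ (-(3 / 4 : ℝ))) := by gcongr
        _ = _ := by ring
  have hnn : ∀ m : ℕ, 0 ≤ ‖omegaB z m‖ * Real.log m ^ A / m := by
    intro m
    rcases Nat.eq_zero_or_pos m with rfl | hm
    · simp
    · have : 0 ≤ Real.log m := Real.log_nonneg (by exact_mod_cast hm)
      positivity
  have hs' : Summable fun m : ℕ => ‖omegaB z m‖ * Real.log m ^ A / m :=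
    Summable.of_nonneg_of_le hnn hdom (hs.mul_left _)
  refine ⟨by rw [omegaB_one, norm_one]; exact le_max_left _ _, hs', ?_⟩
  calc ∑' m : ℕ, ‖omegaB z m‖ * Real.log m ^ A / m
      ≤ ∑' m : ℕ, (4 * A) ^ A * (‖omegaB z m‖ * (m : ℝ) ^ (-(3 / 4 : ℝ))) :=
        hs'.tsum_le_tsum hdom (hs.mul_left _)
    _ = (4 * A) ^ A * ∑' m : ℕ, ‖omegaB z m‖ * (m : ℝ) ^ (-(3 / 4 : ℝ)) := tsum_mul_left
    _ ≤ (4 * A) ^ A * B₀ := by gcongr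
    _ ≤ max 1 ((4 * A) ^ A * B₀) := le_max_right _ _

/-! ### The Euler product at `s = 1`: `∑_m b_z(m)/m = F(1, z)` -/

/-- The complex binomial series `(1 - t)^{-a} = ∑_k multichoose a k · t^k` (`‖t‖ < 1`; Mathlib's
`Complex.one_div_one_sub_cpow_hasFPowerSeriesOnBall_zero`). [folklore] -/
theorem hasSum_multichoose_mul_pow (a : ℂ) {t : ℂ} (ht : ‖t‖ < 1) :
    HasSum (fun k : ℕ => Ring.multichoose a k * t ^ k) ((1 - t) ^ (-a)) := by
  have hp := Complex.one_div_one_sub_cpow_hasFPowerSeriesOnBall_zero a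
  have hmem : t ∈ Metric.eball (0 : ℂ) 1 := by
    simp [Metric.mem_eball, enorm_eq_nnnorm, ← NNReal.coe_lt_one, coe_nnnorm, ht]
  have h := hp.hasSum hmem
  simp only [FormalMultilinearSeries.ofScalars_apply_eq, smul_eq_mul, zero_add] at h
  have hf : (fun k : ℕ => Ring.multichoose a k * t ^ k) =
      fun n : ℕ => Ring.choose (a + n - 1) n * t ^ n := by
    funext n; rw [Ring.multichoose_eq]
  rw [hf, Complex.cpow_neg, ← one_div]
  exact h

/-- **The local Euler factor as a power series**: `∑_k c_z(k) t^k = (1 + (z-1)t)(1-t)^{z-1}` for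
`‖t‖ < 1`. [cite: MontgomeryVaughan2007, §7.4.1 Exercise 3(a)] -/
theorem hasSum_localCoeff_mul_pow (z : ℂ) {t : ℂ} (ht : ‖t‖ < 1) :
    HasSum (fun k : ℕ => localCoeff z k * t ^ k) ((1 + (z - 1) * t) * (1 - t) ^ (z - 1)) := by
  have h1 := hasSum_multichoose_mul_pow (1 - z) ht
  have hS : (1 - t) ^ (-(1 - z)) = (1 - t) ^ (z - 1) := by congr 1; ring
  rw [hS] at h1
  -- the shifted series `∑_k m(k) t^{k+1} = t · S`
  have h2 : HasSum (fun k : ℕ => Ring.multichoose (1 - z) k * t ^ (k + 1)) (t * (1 - t) ^ (z - 1)) := by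
    have h := h1.mul_left t
    have heq : (fun k : ℕ => t * (Ring.multichoose (1 - z) k * t ^ k)) =
        fun k : ℕ => Ring.multichoose (1 - z) k * t ^ (k + 1) := by
      funext k; rw [pow_succ]; ring
    rwa [heq] at h
  -- with a zero inserted at `k = 0`
  set f : ℕ → ℂ := fun k => (if k = 0 then 0 else Ring.multichoose (1 - z) (k - 1)) * t ^ k with hf
  have h3 : HasSum f (t * (1 - t) ^ (z - 1)) := by
    refine (hasSum_nat_add_iff' 1).1 ?_
    have hf1 : (fun k : ℕ => f (k + 1)) = fun k : ℕ => Ring.multichoose (1 - z) k * t ^ (k + 1) := by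
      funext k; simp [hf]
    rw [hf1, Finset.sum_range_one]
    simpa [hf] using h2
  have h4 := h1.add (h3.mul_left (z - 1))
  have heq2 : (fun k : ℕ => localCoeff z k * t ^ k) =
      fun k : ℕ => Ring.multichoose (1 - z) k * t ^ k + (z - 1) * f k := by
    funext k; simp only [hf, localCoeff]; ring
  rw [heq2]
  convert h4 using 1
  ring

/-- **The Euler factor at `s = 1`** in closed form: `E_p(1, z) = (1 + (z-1)/p)(1 - 1/p)^{z-1}`
(`= (1 + z/(p-1))(1-1/p)^z`). [cite: MontgomeryVaughan2007, §7.4.1 Exercise 3(a)] -/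
theorem eulerFactor_one_eq (p : Nat.Primes) (z : ℂ) :
    eulerFactor p 1 z = (1 + (z - 1) * ((p : ℕ) : ℂ)⁻¹) * (1 - ((p : ℕ) : ℂ)⁻¹) ^ (z - 1) := by
  have hp2 : (2 : ℝ) ≤ (p : ℕ) := by exact_mod_cast p.prop.two_le
  have hp0 : ((p : ℕ) : ℂ) ≠ 0 := by exact_mod_cast p.prop.ne_zero
  set t : ℂ := ((p : ℕ) : ℂ)⁻¹ with ht
  have hu : (1 : ℂ) - t ≠ 0 := by
    rw [ht]
    have : ((1 - 1 / ((p : ℕ) : ℝ) : ℝ) : ℂ) = (1 : ℂ) - ((p : ℕ) : ℂ)⁻¹ := by push_cast; ring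
    rw [← this, Complex.ofReal_ne_zero]
    have : 1 / ((p : ℕ) : ℝ) ≤ 1 / 2 := one_div_le_one_div_of_le two_pos hp2
    linarith
  rw [eulerFactor, Complex.cpow_neg_one, ← ht]
  rw [show Complex.exp (z * Complex.log (1 - t)) = (1 - t) ^ z by
    rw [Complex.cpow_def_of_ne_zero hu, mul_comm]]
  rw [Complex.cpow_sub _ _ hu, Complex.cpow_one]
  field_simp
  ring

/-- `∑_e b_z(p^e) p^{-e} = E_p(1, z)`. [cite: MontgomeryVaughan2007, §7.4.1 Exercise 3(a)] -/
theorem tsum_omegaB_prime_pow_div (z : ℂ) (p : Nat.Primes) :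
    ∑' e : ℕ, omegaB z ((p : ℕ) ^ e) / ((((p : ℕ) ^ e : ℕ)) : ℂ) = eulerFactor p 1 z := by
  set t : ℂ := ((p : ℕ) : ℂ)⁻¹ with ht
  have htn : ‖t‖ < 1 := by
    rw [ht, norm_inv, Complex.norm_natCast, inv_lt_one_iff₀]
    exact Or.inr (by exact_mod_cast p.prop.one_lt)
  have h := hasSum_localCoeff_mul_pow z htn
  rw [eulerFactor_one_eq, ← ht, ← h.tsum_eq]
  refine tsum_congr fun e => ?_
  rw [omegaB_prime_pow z p.prop, Nat.cast_pow, div_eq_mul_inv, ← inv_pow]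

/-- **`F(1, z) = ∑_m b_z(m)/m`**: the Euler product of the summable multiplicative function
`m ↦ b_z(m)/m` (Mathlib's `EulerProduct.eulerProduct_tprod`) is `∏_p E_p(1, z) = selbergF 1 z`.
[cite: MontgomeryVaughan2007, §7.4.1 Exercise 3(a)] -/
theorem selbergF_one_eq_tsum_omegaB (z : ℂ) :
    selbergF 1 z = ∑' m : ℕ, omegaB z m / (m : ℂ) := by
  obtain ⟨B, hB⟩ := exists_bound_tsum_norm_omegaB_rpow ‖z‖ (norm_nonneg z)
  obtain ⟨hs, -⟩ := hB z le_rfl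
  set f : ℕ → ℂ := fun m => omegaB z m / (m : ℂ) with hf
  have hf₁ : f 1 = 1 := by simp [hf, omegaB_one]
  have hmul : ∀ {m n : ℕ}, m.Coprime n → f (m * n) = f m * f n := by
    intro m n hmn
    simp only [hf, omegaB, mulFn_mul_of_coprime _ hmn, Nat.cast_mul]
    rw [div_mul_div_comm]
  have hf₀ : f 0 = 0 := by simp [hf]
  have hsum : Summable (fun m => ‖f m‖) := by
    refine Summable.of_nonneg_of_le (fun m => norm_nonneg _) (fun m => ?_) hs
    rcases Nat.eq_zero_or_pos m with rfl | hm
    · simp [hf]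
    · have hm0 : (0 : ℝ) < m := by exact_mod_cast hm
      simp only [hf, norm_div, Complex.norm_natCast]
      rw [div_eq_mul_inv, ← Real.rpow_neg_one]
      gcongr
      · exact_mod_cast hm
      · norm_num
  have h := EulerProduct.eulerProduct_tprod hf₁ hmul hsum hf₀
  rw [← h, selbergF]
  refine tprod_congr fun p => ?_
  simp only [hf]
  exact (tsum_omegaB_prime_pow_div z p).symm

/-! ### From Theorem 7.18 to Selberg's mean value of `z^{ω(n)}` and to Exercise 7.4.3(c) -/

/-- The finite Euler product at `s = 1` is `satheSelbergFC`:
`∏_{p ≤ x} E_p(1, z) = ∏_{p ≤ x} (1 + z/(p-1))(1 - 1/p)^z`. [cite: MontgomeryVaughan2007, §7.4.1 Exercise 3(a)] -/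
theorem prod_eulerFactor_one_eq_satheSelbergFC (x : ℕ) (z : ℂ) :
    ∏ p ∈ (Nat.primesLE x).subtype Nat.Prime, eulerFactor p 1 z = satheSelbergFC x z := by
  rw [prod_subtype_primesLE x (fun p : ℕ => eulerFactor p 1 z), satheSelbergFC_apply]
  refine Finset.prod_congr rfl fun p hp => ?_
  have hpp : p.Prime := (Nat.mem_primesLE.1 hp).2
  have h := eulerFactor_one_eq ⟨p, hpp⟩ z
  simp only at h
  rw [h]
  have hp0 : (p : ℂ) ≠ 0 := by exact_mod_cast hpp.ne_zero
  have hu : (1 : ℂ) - (p : ℂ)⁻¹ ≠ 0 := by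
    rw [← one_div]; exact one_sub_one_div_prime_ne_zero hpp
  have hp1 : (p : ℂ) - 1 ≠ 0 := by
    have : ((((p : ℝ) - 1 : ℝ)) : ℂ) = (p : ℂ) - 1 := by push_cast; ring
    rw [← this, Complex.ofReal_ne_zero]
    have : (2 : ℝ) ≤ p := by exact_mod_cast hpp.two_le
    linarith
  have hz : ((1 : ℂ) - 1 / (p : ℂ)) ^ z = ((1 : ℂ) - (p : ℂ)⁻¹) ^ (z - 1) * ((1 : ℂ) - (p : ℂ)⁻¹) := by
    rw [one_div]
    conv_lhs => rw [show z = (z - 1) + 1 by ring]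
    rw [Complex.cpow_add _ _ hu, Complex.cpow_one]
  rw [hz]
  field_simp
  ring

/-- **Selberg's mean value formula for `z^{ω(n)}` from Theorem 7.18.** Given Montgomery–Vaughan's
Theorem 7.18 (the named fact `MontgomeryVaughan2007_thm_7_18`), for every `R > 0` there is `C` with
`|∑_{n ≤ x} z^{ω(n)} - F_x(z)/Γ(z) · x (log x)^{z-1}| ≤ C x (log x)^{Re z - 2}` for all integers
`x ≥ 2` and `|z| ≤ R` — the hypothesis `hmv` of `MontgomeryVaughan2007_exercise_7_4_3c_of_omegaMeanValue`.
(Theorem 7.18 with `R' = max(R,1)` and `b_z = omegaB z` (`omegaB_hypothesis`); `a_z(n) = z^{ω(n)}`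
(`selbergDelangeCoeff_omegaB`); `F(1,z) = ∑ b_z(m)/m = selbergF 1 z` (`selbergF_one_eq_tsum_omegaB`);
and `F(1,z) - F_x(z) = O_R(x^{-1/2})` (`exists_norm_selbergF_one_sub_prod_le`), whose effect on the
main term is `≪ x^{1/2}(log x)^{Re z-1} ≤ 2x(log x)^{Re z-2}`.)
[cite: MontgomeryVaughan2007, Theorem 7.18 and §7.4.1 Exercise 3(a),(b)] -/
theorem omegaMeanValue_of_thm_7_18 (h : MontgomeryVaughan2007_thm_7_18) :
    ∀ R : ℝ, 0 < R → ∃ C : ℝ, ∀ x : ℕ, 2 ≤ x → ∀ z : ℂ, ‖z‖ ≤ R →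
      ‖(∑ n ∈ Finset.Icc 1 x, z ^ (ArithmeticFunction.cardDistinctFactors n)) -
          satheSelbergFC x z / Complex.Gamma z * (x : ℂ) * ((Real.log x : ℂ) ^ (z - 1))‖ ≤
        C * (x : ℝ) * Real.log x ^ (z.re - 2) := by
  intro R hR
  set R' : ℝ := max R 1 with hR'
  obtain ⟨B, hB⟩ := omegaB_hypothesis R' (le_max_right _ _)
  obtain ⟨C₀, hC₀⟩ := h R' (le_max_right _ _) omegaB ⟨B, hB⟩
  obtain ⟨M, hM0, hM⟩ := exists_bound_satheSelbergFC R hR.le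
  obtain ⟨B₁, hB₁0, hB₁⟩ := exists_bound_selbergF (by norm_num : (1 : ℝ) / 2 < 1) R
  obtain ⟨D, hD0, x₀, hD⟩ := exists_norm_selbergF_one_sub_prod_le R
  -- `‖(Γ z)⁻¹‖ ≤ M_Γ` on `‖z‖ ≤ R`
  have hΓc : ContinuousOn (fun w : ℂ => (Complex.Gamma w)⁻¹) (Metric.closedBall 0 R) :=
    Complex.differentiable_one_div_Gamma.continuous.continuousOn
  obtain ⟨MΓ, hMΓ⟩ := (isCompact_closedBall (0 : ℂ) R).exists_bound_of_continuousOn hΓc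
  have hMΓ0 : 0 ≤ MΓ := (norm_nonneg _).trans (hMΓ 0 (Metric.mem_closedBall_self hR.le))
  -- the tail constant `K`: `‖F(1,z) − F_x(z)‖ ≤ K x^{-1/2}` for all `x ≥ 2`
  set x₁ : ℕ := max x₀ 2 with hx₁
  set K : ℝ := M * D + (B₁ + M) * Real.sqrt x₁ with hK
  have hK0 : 0 ≤ K := by positivity
  have htail : ∀ x : ℕ, 2 ≤ x → ∀ z : ℂ, ‖z‖ ≤ R →
      ‖selbergF 1 z - satheSelbergFC x z‖ ≤ K * (x : ℝ) ^ (-(1 / 2 : ℝ)) := by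
    intro x hx z hz
    have hxpos : (0 : ℝ) < x := by exact_mod_cast (by omega : 0 < x)
    have hxpow : 0 < (x : ℝ) ^ (-(1 / 2 : ℝ)) := Real.rpow_pos_of_pos hxpos _
    rcases le_or_gt x₀ x with hx₀ | hx₀
    · have h1 := hD x hx₀ z hz
      rw [prod_eulerFactor_one_eq_satheSelbergFC] at h1
      calc _ ≤ ‖satheSelbergFC x z‖ * (D * (x : ℝ) ^ (-(1 / 2 : ℝ))) := h1
        _ ≤ M * (D * (x : ℝ) ^ (-(1 / 2 : ℝ))) := by gcongr; exact hM x z hz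
        _ = M * D * (x : ℝ) ^ (-(1 / 2 : ℝ)) := by ring
        _ ≤ K * (x : ℝ) ^ (-(1 / 2 : ℝ)) := by
            gcongr; rw [hK]; nlinarith [Real.sqrt_nonneg (x₁ : ℝ)]
    · -- `x < x₀ ≤ x₁`
      have hxx₁ : (x : ℝ) ≤ x₁ := by rw [hx₁]; exact_mod_cast (le_of_lt hx₀).trans (le_max_left _ _)
      have hx₁pos : (0 : ℝ) < x₁ := hxpos.trans_le hxx₁
      have h1 : ‖selbergF 1 z - satheSelbergFC x z‖ ≤ B₁ + M :=
        (norm_sub_le _ _).trans (add_le_add (hB₁ 1 z (by simp) hz) (hM x z hz))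
      have h2 : Real.sqrt x₁ * (x : ℝ) ^ (-(1 / 2 : ℝ)) ≥ 1 := by
        rw [Real.sqrt_eq_rpow, ge_iff_le]
        have h3 : (x : ℝ) ^ (-(1 / 2 : ℝ)) ≥ (x₁ : ℝ) ^ (-(1 / 2 : ℝ)) :=
          Real.rpow_le_rpow_of_nonpos hxpos hxx₁ (by norm_num)
        calc (1 : ℝ) = (x₁ : ℝ) ^ (1 / 2 : ℝ) * (x₁ : ℝ) ^ (-(1 / 2 : ℝ)) := by
              rw [← Real.rpow_add hx₁pos]; norm_num
          _ ≤ (x₁ : ℝ) ^ (1 / 2 : ℝ) * (x : ℝ) ^ (-(1 / 2 : ℝ)) := by gcongr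
      calc ‖selbergF 1 z - satheSelbergFC x z‖ ≤ (B₁ + M) * 1 := by rw [mul_one]; exact h1
        _ ≤ (B₁ + M) * (Real.sqrt x₁ * (x : ℝ) ^ (-(1 / 2 : ℝ))) := by gcongr
        _ = (B₁ + M) * Real.sqrt x₁ * (x : ℝ) ^ (-(1 / 2 : ℝ)) := by ring
        _ ≤ K * (x : ℝ) ^ (-(1 / 2 : ℝ)) := by gcongr; rw [hK]; nlinarith
  refine ⟨C₀ + 2 * K * MΓ, fun x hx z hz => ?_⟩
  have hzR' : ‖z‖ ≤ R' := hz.trans (le_max_left _ _)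
  have hxpos : (0 : ℝ) < x := by exact_mod_cast (by omega : 0 < x)
  have hL : 0 < Real.log x := Real.log_pos (by exact_mod_cast hx)
  -- Theorem 7.18 at the integer `x`
  have h718 := hC₀ (x : ℝ) (by exact_mod_cast hx) z hzR'
  rw [Nat.floor_natCast] at h718
  have hsum : ∑ n ∈ Finset.Icc 1 x, selbergDelangeCoeff omegaB z n =
      ∑ n ∈ Finset.Icc 1 x, z ^ (ArithmeticFunction.cardDistinctFactors n) := by
    refine Finset.sum_congr rfl fun n hn => selbergDelangeCoeff_omegaB z ?_
    exact Nat.one_le_iff_ne_zero.1 (Finset.mem_Icc.1 hn).1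
  rw [hsum, ← selbergF_one_eq_tsum_omegaB z] at h718
  -- the difference of the two main terms
  set A : ℂ := ∑ n ∈ Finset.Icc 1 x, z ^ (ArithmeticFunction.cardDistinctFactors n) with hA
  set P : ℂ := (x : ℂ) * ((Real.log x : ℂ) ^ (z - 1)) with hP
  have hPn : ‖P‖ = x * Real.log x ^ (z.re - 1) := by
    rw [hP, norm_mul, Complex.norm_natCast, Complex.norm_cpow_eq_rpow_re_of_pos hL]
    simp
  have e1 : selbergF 1 z * (Complex.Gamma z)⁻¹ * (((x : ℕ) : ℝ) : ℂ) * ((Real.log x : ℝ) : ℂ) ^ (z - 1) =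
      selbergF 1 z * (Complex.Gamma z)⁻¹ * P := by rw [hP, Complex.ofReal_natCast]; ring
  have e2 : satheSelbergFC x z / Complex.Gamma z * (x : ℂ) * ((Real.log x : ℂ) ^ (z - 1)) =
      satheSelbergFC x z * (Complex.Gamma z)⁻¹ * P := by rw [hP, div_eq_mul_inv]; ring
  rw [e1] at h718
  rw [e2]
  have hsplit : A - satheSelbergFC x z * (Complex.Gamma z)⁻¹ * P =
      (A - selbergF 1 z * (Complex.Gamma z)⁻¹ * P) +
        (selbergF 1 z - satheSelbergFC x z) * (Complex.Gamma z)⁻¹ * P := by ring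
  rw [hsplit]
  refine (norm_add_le _ _).trans ?_
  have hz' : z ∈ Metric.closedBall (0 : ℂ) R := by simpa using hz
  have hsecond : ‖(selbergF 1 z - satheSelbergFC x z) * (Complex.Gamma z)⁻¹ * P‖ ≤
      2 * K * MΓ * x * Real.log x ^ (z.re - 2) := by
    rw [norm_mul, norm_mul, hPn]
    have h1 := htail x hx z hz
    have h2 := hMΓ z hz'
    -- `log x ≤ 2 √x`
    have hlog : Real.log x ≤ 2 * (x : ℝ) ^ (1 / 2 : ℝ) := by
      have := Real.log_le_rpow_div hxpos.le (by norm_num : (0 : ℝ) < 1 / 2)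
      linarith [this]
    have hLpow : Real.log x ^ (z.re - 1) = Real.log x * Real.log x ^ (z.re - 2) := by
      rw [show z.re - 1 = 1 + (z.re - 2) by ring, Real.rpow_add hL, Real.rpow_one]
    rw [hLpow]
    have hxhalf : (x : ℝ) ^ (-(1 / 2 : ℝ)) * (x : ℝ) ^ (1 / 2 : ℝ) = 1 := by
      rw [← Real.rpow_add hxpos]; norm_num
    calc ‖selbergF 1 z - satheSelbergFC x z‖ * ‖(Complex.Gamma z)⁻¹‖ *
          (x * (Real.log x * Real.log x ^ (z.re - 2)))
        ≤ (K * (x : ℝ) ^ (-(1 / 2 : ℝ))) * MΓ * (x * ((2 * (x : ℝ) ^ (1 / 2 : ℝ)) * Real.log x ^ (z.re - 2))) := by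
          gcongr
      _ = 2 * K * MΓ * x * Real.log x ^ (z.re - 2) * ((x : ℝ) ^ (-(1 / 2 : ℝ)) * (x : ℝ) ^ (1 / 2 : ℝ)) := by
          ring
      _ = 2 * K * MΓ * x * Real.log x ^ (z.re - 2) := by rw [hxhalf, mul_one]
  calc ‖A - selbergF 1 z * (Complex.Gamma z)⁻¹ * P‖ + ‖(selbergF 1 z - satheSelbergFC x z) * (Complex.Gamma z)⁻¹ * P‖
      ≤ C₀ * x * Real.log x ^ (z.re - 2) + 2 * K * MΓ * x * Real.log x ^ (z.re - 2) :=
        add_le_add h718 hsecond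
    _ = (C₀ + 2 * K * MΓ) * x * Real.log x ^ (z.re - 2) := by ring

end SatheSelberg

open SatheSelberg in
/-- **The Sathe–Selberg formula for `ω` from Theorem 7.18** (Montgomery–Vaughan §7.4.1 Exercise 3(c),
via Theorem 7.18 for the Euler product of Exercise 3(a),(b), and the proved passage mean value ⇒
local laws `MontgomeryVaughan2007_exercise_7_4_3c_of_omegaMeanValue`): the named fact
`MontgomeryVaughan2007_exercise_7_4_3c` is a CONSEQUENCE of the named fact
`MontgomeryVaughan2007_thm_7_18` (the Selberg–Delange theorem, general coefficients) — its only
remaining unproved input. [cite: MontgomeryVaughan2007, §7.4.1 Exercise 3(c)] -/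
theorem MontgomeryVaughan2007_exercise_7_4_3c_of_thm_7_18 (h : MontgomeryVaughan2007_thm_7_18) :
    MontgomeryVaughan2007_exercise_7_4_3c :=
  MontgomeryVaughan2007_exercise_7_4_3c_of_omegaMeanValue (omegaMeanValue_of_thm_7_18 h)


end Literature.NumberTheory.LFunctions

end
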